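import Summits.RiemannHypothesis.RiemannHypothesis.Theorems.TiltedLandingLaw421R3PurseBooks
import Summits.RiemannHypothesis.RiemannHypothesis.Theorems.TiltedLandingLaw421R3RateFarC
import Summits.RiemannHypothesis.RiemannHypothesis.Theorems.TiltedLandingLaw421R3GapMeter

/-! # law421 PURSE NODES — every named RATE node of the tree (#1047 … #1060) AT A GENERIC PURSE `P`, one line each — C4 «kernel desk» rh-idea-6 g29
SUPPORT module for crux `TiltedLandingLaw421` (stmt-RiemannHypothesis-24774), `--supports … --as helper` only: proves no stub, no crux; fully proved (no `sorry`).
Director (CA386)(D) «RATE^B HOLD … C4 g29: re-parametrise the books' capital as a variable purse … all of #1046–#1054/#1058 restated once by `mono` lemmas, one image, so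
that RATE′ under the repaired law is a one-line specialisation — image + sha, no landing before the ruling». Sequel of `…R3PurseP` (node: `law421P_of_succ_ratePQ`)
and `…R3PurseBooks` (`slackPQ`, `CapitalLawPQ`, `restRateBotPQ_of_threeBooks`). HERE, for every purse `P ≥ typedPurse` (pointwise on frames with `0 < s`):
* `extraQ P := P − ratePurseQ` (the EXTRA CAPITAL; `extraQ (kappaPurse κ) = (κ − 1)·B`, `extraQ (voidPurse c) = c·voidWidth/s`);
* (CA364) at P: `restRateBotPQ_of_CA364`, `law421P_of_CA364` (#1047 `restRateBotQ_of_CA364` / `law421_of_CA364`);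
* the potential routes at P: `restRateBotPQ_of_laws`, `restRateBotPQ_of_laws_rises` (#1048 Q2);
* capital-funded at P: `residualBudgetPQ P aF aC := S_P − aF − aC = residualBudgetQ aF aC + extraQ P` (`residualBudgetPQ_eq_add`), `capitalLawPQ_residual`,
  `restRateBotPQ_of_capitalFunded`, `law421P_of_capitalFunded` (#1054) — THE ONE-LINE SPECIALISATION: under the repaired law the residual APPROACH allowance grows by
  exactly `extraQ P` (C2's RIDER-94 deficit sits in the approach class: C4 ADD-1);
* c-funded far energy at P: `restRateBotPQ_of_energyLawC`, `law421P_of_energyLawC` (#1058);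
* gap-funded at P: `restRateBotPQ_of_gapDeficit`, `restRateBotPQ_of_gapSelfFunded` (#1060);
* and the trivial direction `restRateBotPQ_of_rateQ_le : RestRateBotQ → typedPurse ≤ P → RestRateBotPQ P` (mono).
The CLASS LAWS (`FarLawQ`, `ConsLawQ`, `ApproachAllowanceQ`, `FarEnergyLaw(C)Q`, `EnergyRiseLawQ`, `GapDeficitLawQ`, …) are purse-FREE and enter VERBATIM. K = bookkeeping about
MODEL sockets; which laws / which P′ are TRUE is open analysis (RATE^B on HOLD per (CA386)(D)). RH is NOT proved; 24774 OPEN. -/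

namespace RhW08.PurseP

open Complex
open RhIdea6.G17.W07C7 RhIdea6.G17.W07C7.Rev6 RhIdea6.G18.W07C8.Law421BirthS RhIdea6.G19.W07C11.Seam
open RhIdea6.G20.W07C12.Frac RhIdea6.G20.W07C12.StColP RhW07.C12.FieldSplit RhIdea6.G21.W07C13.TentMax
open RhW07.C14.TwoSided RhW07.C14.Classes RhW07.C14.Lineage RhW07.C14.Booking
open RhW07.C13.Heredity RhIdea6.G22.W07C15pre.Injection RhW07.E3.Cell
open RhW07.E3.Lit
open RhW08.Round1 RhW08.StSwap RhW08.Round2 RhW08.QuadW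
open RhW08.SealSwap (PBot)
open RhW08.SealSwapQ

section Extra

/-- the EXTRA CAPITAL of purse `P` over the typed purse (a `Budget`). -/
noncomputable def extraQ (P : Purse) : Budget := fun _ f x₀ s hmax R Hs B => P f x₀ s hmax R Hs B - ratePurseQ f x₀ s hmax R Hs B

/-- (K) `S_P = S₀ + extraQ P`. -/
theorem slackPQ_eq_add_extraQ (P : Purse) : slackPQ P = addBudget slack0Q (extraQ P) := by
  funext η f x₀ s hmax R Hs B
  rw [slackPQ_eq_slack0Q_add]
  rfl

/-- (K) the typed purse carries no extra capital. -/
theorem extraQ_typedPurse (η : ℝ) (f : ℂ → ℂ) (x₀ s hmax R Hs : ℝ) (B : ℕ) : extraQ typedPurse η f x₀ s hmax R Hs B = 0 := by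
  simp only [extraQ, ratePurseQ_eq_typedPurse, sub_self]

/-- (K) κ-purse: extra capital `(κ − 1)·B`. -/
theorem extraQ_kappa (κ η : ℝ) (f : ℂ → ℂ) (x₀ s hmax R Hs : ℝ) (B : ℕ) : extraQ (kappaPurse κ) η f x₀ s hmax R Hs B = (κ - 1) * B := by
  simp only [extraQ, kappaPurse, ratePurseQ]
  ring

/-- (K) void purse: extra capital `c·voidWidth/s`. -/
theorem extraQ_void (c η : ℝ) (f : ℂ → ℂ) (x₀ s hmax R Hs : ℝ) (B : ℕ) :
    extraQ (voidPurse c) η f x₀ s hmax R Hs B = c * voidWidth f x₀ R / s := by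
  simp only [extraQ, voidPurse, ratePurseQ]
  ring

/-- (K) `P ≥ typedPurse` iff the extra capital is non-negative (frame-wise). -/
theorem extraQ_nonneg_iff {P : Purse} {η : ℝ} {f : ℂ → ℂ} {x₀ s hmax R Hs : ℝ} {B : ℕ} :
    0 ≤ extraQ P η f x₀ s hmax R Hs B ↔ typedPurse f x₀ s hmax R Hs B ≤ P f x₀ s hmax R Hs B := by
  simp only [extraQ, ← ratePurseQ_eq_typedPurse, sub_nonneg]

/-- (K) the trivial direction: the TYPED stub pays every larger purse (`restRateBotPQ_mono`). -/
theorem restRateBotPQ_of_rateQ_le {P : Purse}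
    (hP : ∀ (f : ℂ → ℂ) (x₀ s hmax R Hs : ℝ) (B : ℕ), 0 < s → typedPurse f x₀ s hmax R Hs B ≤ P f x₀ s hmax R Hs B)
    (h : RestRateBotQ) : RestRateBotPQ P :=
  restRateBotPQ_mono hP (restRateBotPQ_of_rateQ h)

end Extra

section CA364

variable {P : Purse}

/-- ★★ (K) **(CA364) AT PURSE `P`** (#1047 `restRateBotQ_of_CA364`): `FarLawQ aF → ConsLawQ aC → ApproachAllowanceQ aA → CapitalLawPQ P aF aC aA → RestRateBotPQ P`. -/
theorem restRateBotPQ_of_CA364 (hP : ∀ (f : ℂ → ℂ) (x₀ s hmax R Hs : ℝ) (B : ℕ), 0 < s → typedPurse f x₀ s hmax R Hs B ≤ P f x₀ s hmax R Hs B)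
    {aF aC aA : Budget} (hF : FarLawQ aF) (hC : ConsLawQ aC) (hA : ApproachAllowanceQ aA) (hcap : CapitalLawPQ P aF aC aA) :
    RestRateBotPQ P :=
  restRateBotPQ_of_threeBooks_ge hP hF hC hA hcap

/-- ★★ (K) … and with STUB 1 the law at `P` (#1047 `law421_of_CA364`). -/
theorem law421P_of_CA364 (hP : ∀ (f : ℂ → ℂ) (x₀ s hmax R Hs : ℝ) (B : ℕ), 0 < s → typedPurse f x₀ s hmax R Hs B ≤ P f x₀ s hmax R Hs B)
    (hS : RestSuccBotQ) {aF aC aA : Budget} (hF : FarLawQ aF) (hC : ConsLawQ aC) (hA : ApproachAllowanceQ aA) (hcap : CapitalLawPQ P aF aC aA) :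
    Law421P P :=
  law421P_of_succ_ratePQ hS (restRateBotPQ_of_CA364 hP hF hC hA hcap)

/-- (K) #1048 `restRateBotQ_of_laws` at `P`: (R2) + no pre-horizon rise + (C) + count form of (P4) + capital at `P`. -/
theorem restRateBotPQ_of_laws (hP : ∀ (f : ℂ → ℂ) (x₀ s hmax R Hs : ℝ) (B : ℕ), 0 < s → typedPurse f x₀ s hmax R Hs B ≤ P f x₀ s hmax R Hs B)
    {aC aA : Budget} (hR2 : FarEnergyLawQ) (hnr : NoRisePrehorizonQ) (hC : ConsLawQ aC)
    (hA : ApproachCountLawQ aA) (hrA : NoRiseOnQ ApproachLevelQ) (hcap : CapitalLawPQ P energyPurseQ aC aA) : RestRateBotPQ P :=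
  restRateBotPQ_of_CA364 hP (farLawQ_of_energyLaw hR2 hnr) hC (approachAllowanceQ_of_count hA hrA) hcap

/-- (K) #1048 `restRateBotQ_of_laws_rises` at `P`: (R2) + energy-rise allowance + (C) + (P4) + capital at `P`. -/
theorem restRateBotPQ_of_laws_rises (hP : ∀ (f : ℂ → ℂ) (x₀ s hmax R Hs : ℝ) (B : ℕ), 0 < s → typedPurse f x₀ s hmax R Hs B ≤ P f x₀ s hmax R Hs B)
    {aR aC aA : Budget} (hR2 : FarEnergyLawQ) (hr : EnergyRiseLawQ aR) (hC : ConsLawQ aC)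
    (hA : ApproachAllowanceQ aA) (hcap : CapitalLawPQ P (addBudget energyPurseQ aR) aC aA) : RestRateBotPQ P :=
  restRateBotPQ_of_CA364 hP (farLawQ_of_energyLaw_rises hR2 hr) hC hA hcap

end CA364

section CapitalFunded

variable {P : Purse}

/-- the RESIDUAL approach allowance at purse `P`: `S_P − aF − aC`. -/
noncomputable def residualBudgetPQ (P : Purse) (aF aC : Budget) : Budget := fun η f x₀ s hmax R Hs B =>
  slackPQ P η f x₀ s hmax R Hs B - aF η f x₀ s hmax R Hs B - aC η f x₀ s hmax R Hs B

/-- ★ (K) **THE ONE-LINE SPECIALISATION**: the residual allowance at `P` is the tree's residual allowance PLUS the extra capital `extraQ P`. -/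
theorem residualBudgetPQ_eq_add (P : Purse) (aF aC : Budget) : residualBudgetPQ P aF aC = addBudget (residualBudgetQ aF aC) (extraQ P) := by
  funext η f x₀ s hmax R Hs B
  simp only [residualBudgetPQ, residualBudgetQ, addBudget, slackPQ_eq_slack0Q_add, extraQ]
  ring

/-- (K) at the typed purse it is the tree's `residualBudgetQ`. -/
theorem residualBudgetPQ_typed (aF aC : Budget) : residualBudgetPQ typedPurse aF aC = residualBudgetQ aF aC := by
  funext η f x₀ s hmax R Hs B
  simp only [residualBudgetPQ, residualBudgetQ, slackPQ_typedPurse]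

/-- (K) instances: κ-purse `+ (κ − 1)·B`, void purse `+ c·voidWidth/s`. -/
theorem residualBudgetPQ_kappa (κ : ℝ) (aF aC : Budget) (η : ℝ) (f : ℂ → ℂ) (x₀ s hmax R Hs : ℝ) (B : ℕ) :
    residualBudgetPQ (kappaPurse κ) aF aC η f x₀ s hmax R Hs B = residualBudgetQ aF aC η f x₀ s hmax R Hs B + (κ - 1) * B := by
  rw [residualBudgetPQ_eq_add]
  simp only [addBudget, extraQ_kappa]

/-- Residual budget for the void purse. -/
theorem residualBudgetPQ_void (c : ℝ) (aF aC : Budget) (η : ℝ) (f : ℂ → ℂ) (x₀ s hmax R Hs : ℝ) (B : ℕ) :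
    residualBudgetPQ (voidPurse c) aF aC η f x₀ s hmax R Hs B = residualBudgetQ aF aC η f x₀ s hmax R Hs B + c * voidWidth f x₀ R / s := by
  rw [residualBudgetPQ_eq_add]
  simp only [addBudget, extraQ_void]

/-- (K) with the residual allowance the capital fit at `P` is an identity. -/
theorem capitalLawPQ_residual (P : Purse) (aF aC : Budget) : CapitalLawPQ P aF aC (residualBudgetPQ P aF aC) := by
  intro η f x₀ s hmax R Hs B _
  simp only [residualBudgetPQ]
  linarith

/-- ★★ (K) **CAPITAL-FUNDED (CA364) AT `P`** (#1054 `restRateBotQ_of_capitalFunded`): `FarLawQ aF → ConsLawQ aC → ApproachAllowanceQ (S_P − aF − aC) → RestRateBotPQ P`. -/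
theorem restRateBotPQ_of_capitalFunded (hP : ∀ (f : ℂ → ℂ) (x₀ s hmax R Hs : ℝ) (B : ℕ), 0 < s → typedPurse f x₀ s hmax R Hs B ≤ P f x₀ s hmax R Hs B)
    {aF aC : Budget} (hF : FarLawQ aF) (hC : ConsLawQ aC) (hA : ApproachAllowanceQ (residualBudgetPQ P aF aC)) : RestRateBotPQ P :=
  restRateBotPQ_of_CA364 hP hF hC hA (capitalLawPQ_residual P aF aC)

/-- ★★ (K) the same with the allowance SPELLED as «tree residual + extra capital» (the form an engine reads). -/
theorem restRateBotPQ_of_capitalFunded' (hP : ∀ (f : ℂ → ℂ) (x₀ s hmax R Hs : ℝ) (B : ℕ), 0 < s → typedPurse f x₀ s hmax R Hs B ≤ P f x₀ s hmax R Hs B)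
    {aF aC : Budget} (hF : FarLawQ aF) (hC : ConsLawQ aC) (hA : ApproachAllowanceQ (addBudget (residualBudgetQ aF aC) (extraQ P))) :
    RestRateBotPQ P :=
  restRateBotPQ_of_capitalFunded hP hF hC (by rw [residualBudgetPQ_eq_add]; exact hA)

/-- ★★★ (K) … and with STUB 1 the law at `P` (#1054 `law421_of_capitalFunded`). -/
theorem law421P_of_capitalFunded (hP : ∀ (f : ℂ → ℂ) (x₀ s hmax R Hs : ℝ) (B : ℕ), 0 < s → typedPurse f x₀ s hmax R Hs B ≤ P f x₀ s hmax R Hs B)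
    (hS : RestSuccBotQ) {aF aC : Budget} (hF : FarLawQ aF) (hC : ConsLawQ aC) (hA : ApproachAllowanceQ (addBudget (residualBudgetQ aF aC) (extraQ P))) :
    Law421P P :=
  law421P_of_succ_ratePQ hS (restRateBotPQ_of_capitalFunded' hP hF hC hA)

/-- (K) κ-instance: `RestSuccBotQ → FarLawQ aF → ConsLawQ aC → ApproachAllowanceQ (residualBudgetQ aF aC + (κ − 1)·B) → Law421P (kappaPurse κ)` (`κ ≥ 1`). -/
theorem law421Kappa_of_capitalFunded {κ : ℝ} (hκ : 1 ≤ κ) (hS : RestSuccBotQ) {aF aC : Budget} (hF : FarLawQ aF) (hC : ConsLawQ aC)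
    (hA : ApproachAllowanceQ (fun η f x₀ s hmax R Hs B => residualBudgetQ aF aC η f x₀ s hmax R Hs B + (κ - 1) * B)) :
    Law421P (kappaPurse κ) := by
  refine law421P_of_succ_ratePQ hS (restRateBotPQ_of_capitalFunded
    (fun f x₀ s hmax R Hs B _ => typedPurse_le_kappaPurse hκ f x₀ s hmax R Hs B) hF hC ?_)
  have heq : residualBudgetPQ (kappaPurse κ) aF aC = fun η f x₀ s hmax R Hs B => residualBudgetQ aF aC η f x₀ s hmax R Hs B + (κ - 1) * B := by
    funext η f x₀ s hmax R Hs B; exact residualBudgetPQ_kappa κ aF aC η f x₀ s hmax R Hs B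
  rw [heq]; exact hA

/-- (K) void-instance: `RestSuccBotQ → FarLawQ aF → ConsLawQ aC → ApproachAllowanceQ (residualBudgetQ aF aC + c·voidWidth/s) → Law421P (voidPurse c)` (`c ≥ 0`). -/
theorem law421Void_of_capitalFunded {c : ℝ} (hc : 0 ≤ c) (hS : RestSuccBotQ) {aF aC : Budget} (hF : FarLawQ aF) (hC : ConsLawQ aC)
    (hA : ApproachAllowanceQ (fun η f x₀ s hmax R Hs B => residualBudgetQ aF aC η f x₀ s hmax R Hs B + c * voidWidth f x₀ R / s)) :
    Law421P (voidPurse c) := by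
  refine law421P_of_succ_ratePQ hS (restRateBotPQ_of_capitalFunded
    (fun f x₀ s hmax R Hs B hs => typedPurse_le_voidPurse hc f x₀ hs hmax R Hs B) hF hC ?_)
  have heq : residualBudgetPQ (voidPurse c) aF aC = fun η f x₀ s hmax R Hs B => residualBudgetQ aF aC η f x₀ s hmax R Hs B + c * voidWidth f x₀ R / s := by
    funext η f x₀ s hmax R Hs B; exact residualBudgetPQ_void c aF aC η f x₀ s hmax R Hs B
  rw [heq]; exact hA

end CapitalFunded

section FarC

variable {P : Purse}

/-- ★★ (K) **THE c-FUNDED NODE AT `P`** (#1058 `restRateBotQ_of_energyLawC`): `FarEnergyLawCQ c` + `EnergyRiseLawQ aR` + (C) + the residual approach allowance at `P`. -/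
theorem restRateBotPQ_of_energyLawC (hP : ∀ (f : ℂ → ℂ) (x₀ s hmax R Hs : ℝ) (B : ℕ), 0 < s → typedPurse f x₀ s hmax R Hs B ≤ P f x₀ s hmax R Hs B)
    {c : ℝ} {aR aC : Budget} (hc : 0 < c) (hR2 : FarEnergyLawCQ c) (hr : EnergyRiseLawQ aR) (hC : ConsLawQ aC)
    (hA : ApproachAllowanceQ (residualBudgetPQ P (addBudget (scaleBudgetQ c⁻¹ energyPurseQ) (scaleBudgetQ c⁻¹ aR)) aC)) : RestRateBotPQ P :=
  restRateBotPQ_of_capitalFunded hP (farLawQ_of_energyLawC_rises hc hR2 hr) hC hA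

/-- ★★ (K) … and with STUB 1 the law at `P` (#1058 `law421_of_energyLawC`). -/
theorem law421P_of_energyLawC (hP : ∀ (f : ℂ → ℂ) (x₀ s hmax R Hs : ℝ) (B : ℕ), 0 < s → typedPurse f x₀ s hmax R Hs B ≤ P f x₀ s hmax R Hs B)
    (hS : RestSuccBotQ) {c : ℝ} {aR aC : Budget} (hc : 0 < c) (hR2 : FarEnergyLawCQ c) (hr : EnergyRiseLawQ aR) (hC : ConsLawQ aC)
    (hA : ApproachAllowanceQ (residualBudgetPQ P (addBudget (scaleBudgetQ c⁻¹ energyPurseQ) (scaleBudgetQ c⁻¹ aR)) aC)) : Law421P P :=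
  law421P_of_succ_ratePQ hS (restRateBotPQ_of_energyLawC hP hc hR2 hr hC hA)

end FarC

section Gap

variable {P : Purse}

/-- ★★ (K) **THE GAP-FUNDED NODE AT `P`** (#1060 `restRateBotQ_of_gapDeficit`). -/
theorem restRateBotPQ_of_gapDeficit (hP : ∀ (f : ℂ → ℂ) (x₀ s hmax R Hs : ℝ) (B : ℕ), 0 < s → typedPurse f x₀ s hmax R Hs B ≤ P f x₀ s hmax R Hs B)
    {κ : ℝ} {aF aC aD : Budget} (hF : FarLawQ aF) (hC : ConsLawQ aC) (hκ : 0 < κ)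
    (hG : GapDeficitLawQ κ aD) (hcap : CapitalLawPQ P aF aC (addBudget (purseOfQ (gapMeterQ κ)) aD)) : RestRateBotPQ P :=
  restRateBotPQ_of_CA364 hP hF hC (approachAllowanceQ_of_gapDeficit hκ hG) hcap

/-- ★★ (K) **THE SELF-FUNDED GAP NODE AT `P`** (#1060 `restRateBotQ_of_gapSelfFunded`). -/
theorem restRateBotPQ_of_gapSelfFunded (hP : ∀ (f : ℂ → ℂ) (x₀ s hmax R Hs : ℝ) (B : ℕ), 0 < s → typedPurse f x₀ s hmax R Hs B ≤ P f x₀ s hmax R Hs B)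
    {κ c : ℝ} {aF aC : Budget} (hF : FarLawQ aF) (hC : ConsLawQ aC) (hκ : 0 < κ)
    (hG : GapSelfFundedLawQ κ c) (hcap : CapitalLawPQ P aF aC (scaleBudgetGapQ (1 + c) (purseOfQ (gapMeterQ κ)))) : RestRateBotPQ P :=
  restRateBotPQ_of_CA364 hP hF hC (approachAllowanceQ_of_gapSelfFunded hκ hG) hcap

end Gap

end RhW08.PurseP
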